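import Literature.NumberTheory.Automorphic.SymplecticSatakeInverseExpansion
import Literature.NumberTheory.Automorphic.SymplecticHeckeAlgebraStructure
import HarnessLib

/-!
# Henniart–Vignéras §7.16 for `Sp_{2n}`: the twisted invariants `𝒯_R(q) = 𝒮_1(ℋ(Sp_{2n}, K₀; R))` are generated, as an `R`-algebra,
# by the `n` fundamental twisted orbit sums `S_{ε_1}, …, S_{ε_n}`; `ℋ(Sp_{2n}(K), Sp_{2n}(𝒪); R)` is of finite type (every `R`)

Topic `NumberTheory/Automorphic`; namespace `Literature.NumberTheory.Automorphic.SymplecticCartan` (lane `lit-hodgefound`,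
Track 2 foundations; seat `lit-hodgefound-p11`, generation 50, row g50-#15).  THEOREMS ONLY: no definition, no named fact, no
instance, no notation.  A rider to g50-#13/#14 (`SymplecticSatakeOrbitSumTriangular`, `SymplecticSatakeInverseExpansion`) and the
tree's `SymplecticHeckeAlgebraStructure` (`ℋ = R[T_{d(ε_1)}, …, T_{d(ε_n)}]`).

## The print

[HenniartVigneras2013] §7.16 THEOREM: «For any commutative ring `C`, the `C`-algebra `H(G, K, C)` is finitely generated», with
proof: «Applying `S_ℤ`, it amounts to proving that the algebra `ℤ[Λ]^{W_0}` of elements in `ℤ[Λ]` invariant under the twisted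
action of `W_0`, is finitely generated. […] Choose a finite system of generators `λ_1, …, λ_r` of the monoid `Λ⁻`. […] it
follows that the algebra homomorphism from `ℤ[X_1, …, X_r]` to `ℤ[Λ]^{W_0}`, sending `X_i` to `S_{λ_i}` for `i = 1, …, r`, is
surjective».  HERE `G = Sp_{2n}(K)`, `Λ = ℤⁿ`, the dominant cone `Λ⁺` (the tree's convention, g50-#8) is the free monoid on the
fundamental coweights `ε_r = (1^{r}, 0^{n-r})` (`1 ≤ r ≤ n`; indexed below by `r : Fin n` as `i ↦ 𝟙_{i ≤ r}`, the indexing of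
`SymplecticHeckeAlgebraStructure`), and the route is the tree's: `ℋ_R = R[T_{d(ε_r)} : r]`
(`adjoin_doubleCosetOperator_fundamental_eq_top_symplectic`), `𝒮_1` an algebra homomorphism onto `𝒯_R(q)` (g50-#8), and
`𝒮_1(T_{d(ε_r)}) = S_{ε_r} + ∑_{λ} n(λ) S_λ` (g50-#13) where the dominant `λ ≠ ε_r` dominance-below `ε_r` are exactly `0` and the
`ε_{r'}`, `r' < r` (`eq_zero_or_exists_eq_fundamental_of_headSum_le`) — so `R[S_{ε_r} : r] = R[𝒮_1(T_{d(ε_r)}) : r] = 𝒮_1(ℋ_R)`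
by a triangular induction on `r`.

## What is formalised (theorems only)

* §1 `eq_ite_lt_card_of_antitone_of_forall_mem` (an antitone `{0,1}`-vector is `𝟙_{i < m}`, `m` its number of ones),
  **`eq_zero_or_exists_eq_fundamental_of_headSum_le`** (dominant `λ` dominance-below `ε_r` is `0` or some `ε_{r'}`, `r' ≤ r`).
* §2 `symplecticTwistedOrbitSum_zero` (`S_0 = 1`), `twistedOrbitSum_fundamental_mem_adjoin_satakeTransform`,
  `satakeTransform_cartan_fundamental_mem_adjoin_twistedOrbitSum`,
  **`adjoin_twistedOrbitSum_fundamental_eq_range`** (HV §7.16 for `Sp_{2n}`: `R[S_{ε_1}, …, S_{ε_n}] = 𝒮_1(ℋ_R)`),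
  **`adjoin_twistedOrbitSum_fundamental_eq_twistedTarget`** (`= 𝒯_R(q)` as `R`-submodules),
  `finiteType_heckeAlgebra_symplecticInt` (HV §7.16 THM. verbatim: `ℋ(Sp_{2n}(K), Sp_{2n}(𝒪); R)` is of finite type over `R`).

## References
* [HenniartVigneras2013] G. Henniart, M.-F. Vignéras, *A Satake isomorphism for representations modulo p of reductive groups over
  local fields*, J. reine angew. Math. 701 (2015), §7.14, §7.16 (read p. 59–60).
* [BourbakiLie4to6] N. Bourbaki, *Groupes et algèbres de Lie*, Ch. VI §3 no. 4 (the model of HV's argument).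
* [GrossSatake1998] B. H. Gross, *On the Satake isomorphism* (1998), (3.11)–(3.13).
-/

noncomputable section

open scoped Valued WithZero MatrixGroups
open Matrix MonoidAlgebra Representation

namespace Literature.NumberTheory.Automorphic.SymplecticCartan

open Literature.NumberTheory.Automorphic Literature.NumberTheory.Automorphic.CartanUnique
  Literature.NumberTheory.Automorphic.HermitianLattice

variable {R : Type*} [CommRing R] {n : ℕ}

/-! ## §1 Dominant cocharacters below a fundamental coweight -/

section Combinatorics

omit [CommRing R]

/-- An antitone `{0,1}`-valued vector is the indicator of an initial segment: `λ_i = 𝟙_{i < m}`, `m = #{i : λ_i = 1}`.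
[cite: HenniartVigneras2013, §7.16] -/
theorem eq_ite_lt_card_of_antitone_of_forall_mem {la : Fin n → ℤ} (hla : Antitone la) (h01 : ∀ i, la i = 0 ∨ la i = 1) :
    la = fun i : Fin n => if (i : ℕ) < (Finset.univ.filter fun j => la j = 1).card then (1 : ℤ) else 0 := by
  classical
  funext i
  by_cases hi : (i : ℕ) < (Finset.univ.filter fun j => la j = 1).card
  · rw [if_pos hi]
    by_contra h0
    have hz : la i = 0 := (h01 i).resolve_right h0
    -- all ones lie strictly below `i`
    have hsub : (Finset.univ.filter fun j => la j = 1) ⊆ Finset.Iio i := by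
      intro j hj
      rw [Finset.mem_filter] at hj
      rw [Finset.mem_Iio]
      by_contra hle
      have h1 := hla (not_lt.1 hle)
      rw [hz, hj.2] at h1
      exact absurd h1 (by norm_num)
    have hcard := Finset.card_le_card hsub
    rw [Fin.card_Iio] at hcard
    omega
  · rw [if_neg hi]
    by_contra h1
    have ho : la i = 1 := (h01 i).resolve_left h1
    -- all `j ≤ i` are ones
    have hsub : Finset.Iic i ⊆ Finset.univ.filter fun j => la j = 1 := by
      intro j hj
      rw [Finset.mem_Iic] at hj
      rw [Finset.mem_filter]
      refine ⟨Finset.mem_univ _, ?_⟩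
      have h2 := hla hj
      rw [ho] at h2
      rcases h01 j with h | h
      · rw [h] at h2; exact absurd h2 (by norm_num)
      · exact h
    have hcard := Finset.card_le_card hsub
    rw [Fin.card_Iic] at hcard
    omega

/-- **A dominant cocharacter dominance-below the fundamental coweight `ε_r = 𝟙_{· ≤ r}` is `0` or a fundamental coweight `ε_{r'}`,
`r' ≤ r`** (its entries are `≤ λ_0 ≤ 1`). [cite: HenniartVigneras2013, §7.14, §7.16] -/
theorem eq_zero_or_exists_eq_fundamental_of_headSum_le {la : Fin n → ℤ} (hla : Antitone la ∧ ∀ i, 0 ≤ la i) (r : Fin n)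
    (hle : ∀ s : ℕ, headSum la s ≤ headSum (fun i : Fin n => ((if (i : ℕ) ≤ (r : ℕ) then (1 : ℕ) else 0 : ℕ) : ℤ)) s) :
    la = 0 ∨ ∃ r' : Fin n, (r' : ℕ) ≤ r ∧ la = fun i : Fin n => ((if (i : ℕ) ≤ (r' : ℕ) then (1 : ℕ) else 0 : ℕ) : ℤ) := by
  classical
  rcases Nat.eq_zero_or_pos n with hn | hn
  · subst hn; exact Or.inl (funext fun i => i.elim0)
  -- `λ_0 ≤ 1`, hence all entries are `0` or `1`
  have e1 : ∀ μ : Fin n → ℤ, headSum μ 1 = μ ⟨0, hn⟩ := fun μ => by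
    have h := headSum_succ μ ⟨0, hn⟩
    simp only [headSum_zero, zero_add] at h
    exact h
  have h0 : la ⟨0, hn⟩ ≤ 1 := by
    have h := hle 1
    rw [e1, e1] at h
    simpa using h
  have h01 : ∀ i, la i = 0 ∨ la i = 1 := fun i => by
    have h1 := hla.1 (Fin.le_def.2 (Nat.zero_le (i : ℕ)) : (⟨0, hn⟩ : Fin n) ≤ i)
    have h2 := hla.2 i
    omega
  have hind := eq_ite_lt_card_of_antitone_of_forall_mem hla.1 h01
  -- the number of ones
  obtain ⟨m, hm⟩ : ∃ m : ℕ, m = (Finset.univ.filter fun j => la j = 1).card := ⟨_, rfl⟩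
  rw [← hm] at hind
  rcases Nat.eq_zero_or_pos m with hm0 | hm0
  · refine Or.inl ?_
    rw [hind]
    funext i
    rw [if_neg (by omega), Pi.zero_apply]
  · -- `m ≤ n` and `m ≤ r + 1` from the total sums
    have hmn : m ≤ n := by
      rw [hm]; exact (Finset.card_filter_le _ _).trans (by rw [Finset.card_univ, Fintype.card_fin])
    have hL : headSum la n = m := by
      rw [headSum_eq]
      have h1 : ∀ i : Fin n, (if (i : ℕ) < n then la i else 0) = if la i = 1 then (1 : ℤ) else 0 := fun i => by
        rw [if_pos i.isLt]; rcases h01 i with h | h <;> simp [h]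
      rw [Finset.sum_congr rfl fun i _ => h1 i, Finset.sum_boole, ← hm]
    have hR : headSum (fun i : Fin n => ((if (i : ℕ) ≤ (r : ℕ) then (1 : ℕ) else 0 : ℕ) : ℤ)) n = (r : ℕ) + 1 := by
      rw [headSum_eq]
      have h1 : ∀ i : Fin n, (if (i : ℕ) < n then (((if (i : ℕ) ≤ (r : ℕ) then (1 : ℕ) else 0 : ℕ) : ℤ)) else 0) =
          if (i : ℕ) ≤ (r : ℕ) then (1 : ℤ) else 0 := fun i => by
        rw [if_pos i.isLt]
        split_ifs <;> simp
      have hI : (Finset.univ.filter fun i : Fin n => (i : ℕ) ≤ (r : ℕ)) = Finset.Iic r := by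
        ext i
        simp only [Finset.mem_filter, Finset.mem_univ, true_and, Finset.mem_Iic, Fin.le_iff_val_le_val]
      rw [Finset.sum_congr rfl fun i _ => h1 i, Finset.sum_boole, hI, Fin.card_Iic, Nat.cast_add, Nat.cast_one]
    have htot := hle n
    rw [hL, hR] at htot
    have hmr : m ≤ (r : ℕ) + 1 := by exact_mod_cast htot
    have hlt' : m - 1 < n := by omega
    refine Or.inr ⟨⟨m - 1, hlt'⟩, by change m - 1 ≤ (r : ℕ); omega, ?_⟩
    clear hm hL htot
    rw [hind]
    funext i
    by_cases h : (i : ℕ) < m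
    · rw [if_pos h, if_pos (by change (i : ℕ) ≤ m - 1; omega)]; norm_num
    · rw [if_neg h, if_neg (by change ¬ (i : ℕ) ≤ m - 1; omega)]; norm_num

end Combinatorics

/-! ## §2 Generation by the fundamental twisted orbit sums -/

/-- **`S_0 = 1`**: the twisted orbit sum of the zero cocharacter is the unit of `R[ℤⁿ]`. [cite: HenniartVigneras2013, §7.13] -/
theorem symplecticTwistedOrbitSum_zero (b : ℕ) : symplecticTwistedOrbitSum R n b (0 : Fin n → ℤ) = 1 := by
  have h0 : Antitone (0 : Fin n → ℤ) ∧ ∀ i, (0 : ℤ) ≤ (0 : Fin n → ℤ) i := ⟨antitone_const, fun _ => le_rfl⟩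
  classical
  refine AddMonoidAlgebra.coeff_injective (Finsupp.ext fun μ => ?_)
  rw [coeff_symplecticTwistedOrbitSum, AddMonoidAlgebra.one_def, AddMonoidAlgebra.coeff_single, Finsupp.single_apply]
  by_cases hμ : μ ∈ signedPermOrbit (0 : Fin n → ℤ)
  · obtain ⟨ε, π, rfl⟩ := mem_signedPermOrbit_iff.1 hμ
    have hz : (fun i => (ε i : ℤ) * (0 : Fin n → ℤ) (π i)) = 0 := funext fun i => by rw [Pi.zero_apply, mul_zero, Pi.zero_apply]
    rw [if_pos hμ, hz, if_pos rfl, sub_self, Int.toNat_zero, pow_zero]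
  · rw [if_neg hμ, if_neg]
    rintro rfl
    exact hμ (self_mem_signedPermOrbit _)

section Hecke

variable {K : Type*} [Field K] [Valued K ℤᵐ⁰] {ϖ : K} [CompactSpace 𝒪[K]] [Finite 𝓀[K]]
  [IsHeckeTriple (⊤ : Submonoid (symplecticGroup (Fin n) K)) (symplecticInt (Fin n) K) (symplecticInt (Fin n) K)]

/-- **Triangular step, one direction**: every fundamental twisted orbit sum `S_{ε_r}` lies in the `R`-algebra generated by the
transforms `𝒮_1(T_{d(ε_{r'})})` of the fundamental Cartan operators (induction on `r`, using
`𝒮_1(T_{d(ε_r)}) = S_{ε_r} + ∑ n(λ) S_λ` with `λ ∈ {0, ε_0, …, ε_{r-1}}`). [cite: HenniartVigneras2013, §7.14, §7.16] -/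
theorem twistedOrbitSum_fundamental_mem_adjoin_satakeTransform (hϖ : Valued.v ϖ = WithZero.exp (-1 : ℤ)) (r : Fin n) :
    symplecticTwistedOrbitSum R n (Nat.card 𝓀[K]) (fun i : Fin n => ((if (i : ℕ) ≤ (r : ℕ) then (1 : ℕ) else 0 : ℕ) : ℤ)) ∈
      Algebra.adjoin R (Set.range fun r' : Fin n =>
        symplecticSatakeTransform hϖ (1 : Rˣ) (symplecticCartanOperator R hϖ fun i : Fin n => if (i : ℕ) ≤ (r' : ℕ) then 1 else 0)) := by
  suffices H : ∀ (m : ℕ) (r : Fin n), (r : ℕ) = m →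
      symplecticTwistedOrbitSum R n (Nat.card 𝓀[K]) (fun i : Fin n => ((if (i : ℕ) ≤ (r : ℕ) then (1 : ℕ) else 0 : ℕ) : ℤ)) ∈
        Algebra.adjoin R (Set.range fun r' : Fin n =>
          symplecticSatakeTransform hϖ (1 : Rˣ) (symplecticCartanOperator R hϖ fun i : Fin n => if (i : ℕ) ≤ (r' : ℕ) then 1 else 0)) from
    H _ r rfl
  intro m
  induction m using Nat.strong_induction_on with
  | _ m ih =>
  intro r hr
  have ha : Antitone (fun i : Fin n => if (i : ℕ) ≤ (r : ℕ) then (1 : ℕ) else 0) := by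
    intro i j hij
    have := Fin.le_def.1 hij
    simp only
    split_ifs <;> omega
  -- the expansion of `𝒮_1(T_{d(ε_r)})`
  have hexp := symplecticSatakeTransform_one_cartan_eq_twistedOrbitSum_add (R := R) hϖ ha
  rw [← symplecticCartanOperator_def hϖ] at hexp
  have hmem : symplecticSatakeTransform hϖ (1 : Rˣ) (symplecticCartanOperator R hϖ fun i : Fin n => if (i : ℕ) ≤ (r : ℕ) then 1 else 0) ∈
      Algebra.adjoin R (Set.range fun r' : Fin n =>
        symplecticSatakeTransform hϖ (1 : Rˣ) (symplecticCartanOperator R hϖ fun i : Fin n => if (i : ℕ) ≤ (r' : ℕ) then 1 else 0)) :=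
    Algebra.subset_adjoin ⟨r, rfl⟩
  rw [hexp] at hmem
  -- every other term of the expansion is in the adjoin by induction
  have hrest : (∑ la ∈ ((symplecticSatakeTransform hϖ (1 : Rˣ) (symplecticCartanOperator R hϖ fun i : Fin n =>
        if (i : ℕ) ≤ (r : ℕ) then 1 else 0)).coeff.support.filter (fun la => Antitone la ∧ ∀ i, 0 ≤ la i)).erase
          (fun i : Fin n => ((if (i : ℕ) ≤ (r : ℕ) then (1 : ℕ) else 0 : ℕ) : ℤ)),
        (symplecticSatakeTransform hϖ (1 : Rˣ) (symplecticCartanOperator R hϖ fun i : Fin n => if (i : ℕ) ≤ (r : ℕ) then 1 else 0)).coeff la •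
          symplecticTwistedOrbitSum R n (Nat.card 𝓀[K]) la) ∈
      Algebra.adjoin R (Set.range fun r' : Fin n =>
        symplecticSatakeTransform hϖ (1 : Rˣ) (symplecticCartanOperator R hϖ fun i : Fin n => if (i : ℕ) ≤ (r' : ℕ) then 1 else 0)) := by
    refine Subalgebra.sum_mem _ fun la hla => Subalgebra.smul_mem _ ?_ _
    have hidx := ne_and_headSum_le_of_mem_erase_support_symplectic (R := R) hϖ ha (la := la)
      (by rw [← symplecticCartanOperator_def hϖ]; exact hla)
    rcases eq_zero_or_exists_eq_fundamental_of_headSum_le hidx.2.1 r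
        (fun s => by rw [headSum_eq, headSum_eq]; exact hidx.2.2 s) with h0 | ⟨r', hr', hla'⟩
    · rw [h0, symplecticTwistedOrbitSum_zero]; exact Subalgebra.one_mem _
    · rw [hla']
      have hne : (r' : ℕ) ≠ r := by
        intro h
        apply hidx.1
        rw [hla']
        funext i
        rw [h]
      exact ih (r' : ℕ) (by omega) r' rfl
  have h := Subalgebra.sub_mem _ hmem hrest
  rwa [add_sub_cancel_right] at h

/-- **Triangular step, other direction**: `𝒮_1(T_{d(ε_r)}) ∈ R[S_{ε_0}, …, S_{ε_{n-1}}]`. [cite: HenniartVigneras2013, §7.14, §7.16] -/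
theorem satakeTransform_cartan_fundamental_mem_adjoin_twistedOrbitSum (hϖ : Valued.v ϖ = WithZero.exp (-1 : ℤ)) (r : Fin n) :
    symplecticSatakeTransform hϖ (1 : Rˣ) (symplecticCartanOperator R hϖ fun i : Fin n => if (i : ℕ) ≤ (r : ℕ) then 1 else 0) ∈
      Algebra.adjoin R (Set.range fun r' : Fin n =>
        symplecticTwistedOrbitSum R n (Nat.card 𝓀[K]) (fun i : Fin n => ((if (i : ℕ) ≤ (r' : ℕ) then (1 : ℕ) else 0 : ℕ) : ℤ))) := by
  have ha : Antitone (fun i : Fin n => if (i : ℕ) ≤ (r : ℕ) then (1 : ℕ) else 0) := by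
    intro i j hij
    have := Fin.le_def.1 hij
    simp only
    split_ifs <;> omega
  have hexp := symplecticSatakeTransform_one_cartan_eq_twistedOrbitSum_add (R := R) hϖ ha
  rw [← symplecticCartanOperator_def hϖ] at hexp
  rw [hexp]
  refine Subalgebra.add_mem _ (Algebra.subset_adjoin ⟨r, rfl⟩) (Subalgebra.sum_mem _ fun la hla => Subalgebra.smul_mem _ ?_ _)
  have hidx := ne_and_headSum_le_of_mem_erase_support_symplectic (R := R) hϖ ha (la := la)
    (by rw [← symplecticCartanOperator_def hϖ]; exact hla)
  rcases eq_zero_or_exists_eq_fundamental_of_headSum_le hidx.2.1 r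
      (fun s => by rw [headSum_eq, headSum_eq]; exact hidx.2.2 s) with h0 | ⟨r', -, hla'⟩
  · rw [h0, symplecticTwistedOrbitSum_zero]; exact Subalgebra.one_mem _
  · rw [hla']; exact Algebra.subset_adjoin ⟨r', rfl⟩

/-- **HENNIART–VIGNÉRAS §7.16 FOR `Sp_{2n}`: the `R`-algebra generated by the `n` fundamental twisted orbit sums
`S_{ε_1}, …, S_{ε_n}` is the image `𝒮_1(ℋ(Sp_{2n}(K), Sp_{2n}(𝒪); R))` of the counting Satake transform** (= the twisted invariants
`𝒯_R(q)`, g50-#8), for every commutative ring `R`. [cite: HenniartVigneras2013, §7.16] -/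
theorem adjoin_twistedOrbitSum_fundamental_eq_range (hϖ : Valued.v ϖ = WithZero.exp (-1 : ℤ)) :
    Algebra.adjoin R (Set.range fun r : Fin n =>
        symplecticTwistedOrbitSum R n (Nat.card 𝓀[K]) (fun i : Fin n => ((if (i : ℕ) ≤ (r : ℕ) then (1 : ℕ) else 0 : ℕ) : ℤ))) =
      (symplecticSatakeTransform (n := n) (K := K) hϖ (1 : Rˣ)).range := by
  -- `𝒮_1(ℋ) = 𝒮_1(R[T_{d(ε_r)}]) = R[𝒮_1(T_{d(ε_r)})]`
  have hrange : (symplecticSatakeTransform (n := n) (K := K) hϖ (1 : Rˣ)).range =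
      Algebra.adjoin R (Set.range fun r' : Fin n =>
        symplecticSatakeTransform hϖ (1 : Rˣ) (symplecticCartanOperator R hϖ fun i : Fin n => if (i : ℕ) ≤ (r' : ℕ) then 1 else 0)) := by
    rw [← Algebra.map_top, ← adjoin_doubleCosetOperator_fundamental_eq_top_symplectic (n := n) (R := R) hϖ, AlgHom.map_adjoin,
      ← Set.range_comp]
    rfl
  rw [hrange]
  refine le_antisymm (Algebra.adjoin_le ?_) (Algebra.adjoin_le ?_)
  · rintro _ ⟨r, rfl⟩
    exact twistedOrbitSum_fundamental_mem_adjoin_satakeTransform hϖ r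
  · rintro _ ⟨r, rfl⟩
    exact satakeTransform_cartan_fundamental_mem_adjoin_twistedOrbitSum hϖ r

/-- The same with the twisted invariants as target: **`R[S_{ε_1}, …, S_{ε_n}] = 𝒯_R(q)`** (as `R`-submodules of `R[ℤⁿ]`).
[cite: HenniartVigneras2013, §7.16] -/
theorem adjoin_twistedOrbitSum_fundamental_eq_twistedTarget (hϖ : Valued.v ϖ = WithZero.exp (-1 : ℤ)) :
    Subalgebra.toSubmodule (Algebra.adjoin R (Set.range fun r : Fin n =>
        symplecticTwistedOrbitSum R n (Nat.card 𝓀[K]) (fun i : Fin n => ((if (i : ℕ) ≤ (r : ℕ) then (1 : ℕ) else 0 : ℕ) : ℤ)))) =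
      symplecticTwistedTarget R n (Nat.card 𝓀[K]) := by
  rw [adjoin_twistedOrbitSum_fundamental_eq_range hϖ, ← range_symplecticSatakeTransform_one_eq_twisted hϖ]
  rfl

omit [CompactSpace 𝒪[K]] [Finite 𝓀[K]] in
/-- **HENNIART–VIGNÉRAS §7.16 THEOREM FOR `Sp_{2n}`: `ℋ(Sp_{2n}(K), Sp_{2n}(𝒪); R)` is a finitely generated `R`-algebra**, for every
commutative ring `R` (from the tree's `ℋ_R ≅ R[X_1, …, X_n]`). [cite: HenniartVigneras2013, §7.16] -/
theorem finiteType_heckeAlgebra_symplecticInt (hϖ : Valued.v ϖ = WithZero.exp (-1 : ℤ)) :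
    Algebra.FiniteType R (heckeAlgebra R (symplecticGroup (Fin n) K) (symplecticInt (Fin n) K)) := by
  obtain ⟨e, -⟩ := exists_algEquiv_mvPolynomial_heckeAlgebra_symplecticInt (n := n) (R := R) hϖ
  exact Algebra.FiniteType.equiv (inferInstance : Algebra.FiniteType R (MvPolynomial (Fin n) R)) e

end Hecke

end Literature.NumberTheory.Automorphic.SymplecticCartan

end
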